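/-
Origin: expansion seat `planner-pub-hodgecm-pv14-0`, handover 2026-08-18T04:00:28Z (`HOME/pub-hodgecm-pv14/lean/Pv14/PerL34/P36Bridge.lean`, md5 3dd2cbb0, 136 lines);
landed by the gen-5 packager in gate run 21 as `HodgeCM/PerL34/P36_bridge.lean` (import ^import Pv[0-9]+copy\.(?:PerL34\.)?→import HodgeCM.PerL34. ×1; import ^import Pv14\.PerL34\.P36AbsConv\b→import HodgeCM.PerL34.P36_absConv ×1).
-/
/-
Origin: HOME/pub-hodgecm-pv14/lean/Pv14/PerL34/P36Bridge.lean — session planner-pub-hodgecm-pv14-0 (unit pub-hodgecm-pv14,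
DAG-NODE PROVER #14).  Intended final place: `HodgeCM/PerL34/P36_bridge.lean`, AFTER (in build order)
`HodgeCM/PerL34/P36_unfolding.lean` (pv14, landed run 19), `HodgeCM/PerL34/P36_absConv.lean` (pv14, handed over
03:55Z) and pv09's `HodgeCM/PerL34/P36UnfoldStep1.lean` (handed over by pv09; here imported from a byte-identical
local copy `Pv09copy.P36UnfoldStep1` of pv09's file md5 56717558 with only its import line rewritten to the landed
`HodgeCM.PerL34.RallisUnfold` — PACKAGER: rewrite `import Pv09copy.P36UnfoldStep1` to pv09's landed module name and
`import Pv14.PerL34.P36AbsConv` to `HodgeCM.PerL34.P36_absConv`; do NOT land the `Pv09copy/` file).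
DAG node **N23b** (Prop 3.6 Step 1, tex ll. 413–421) END TO END: the typed INPUT `Step1Data.UnfoldingIdentity` of
`P36_unfolding.lean` is DERIVED from pv09's scalar unfolding identity + pv09's Bochner upgrade + pv14's absolute
convergence, leaving only DEFINITIONAL evaluation formulas (the definitions of `𝒯_Φ`, `ϑ_{T,χ}`, `θ_{ω(h)Φ}`, `E^χ_f`)
and node N18's continuity as named hypotheses.  KERNEL glue; nothing asserted.
-/
import Summits.HodgeConjecture.HodgeCM.PerL34.P36_unfolding
import Summits.HodgeConjecture.HodgeCM.PerL34.P36_absConv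
import Summits.HodgeConjecture.HodgeCM.PerL34.P36UnfoldStep1

set_option autoImplicit false

/-!
# N23b end to end: `UnfoldingIdentity` from the fundamental-domain model

Dictionary (pv09's model ↔ pv14's `Step1Data`): `U = U(W)(𝔸)` with left Haar measure `D.dh = μ`, `Γ = U(W)(L₀)`
with fundamental domain `𝓕 = [U(W)]`, `T = T(𝔸)`, `jT : T →* U`, `𝓕T = [T]` (finite `ν`-measure), `K = [G_U]`
(compact), `ι : C(K,ℂ) →L[ℂ] H` (`H = L²([G_U])`), `θ Φ' g y = θ_{Φ'}(g,y)` the theta kernel, `χc χ : T → ℂ` the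
character `χ` as a function, `Efun χ f = E^χ_f` as a function on `U(W)(𝔸)`.

HYPOTHESES of `unfoldingIdentity_of` and their status:
* DEFINITIONAL evaluation formulas — `hTι`/`hTev`: `𝒯_Φ(E^χ_f) = ι(g ↦ ∫_{[U(W)]} θ_Φ(g,y) E^χ_f(y) dy)` (tex l. 380,
  the definition of `𝒯_Φ`; that this IS a bounded operator into `L²` is node N21, pv05 `KernelOperator`);
  `hϑι`/`hϑev`: `ϑ_{T,χ}(Φ') = ι(g ↦ ∫_{[T]} θ_{Φ'}(g,t) χ(t) dt)` (tex l. 346); `hθω`: `θ_{ω(h)Φ}(g,y) = θ_Φ(g,yh)`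
  (tex l. 418); `hE`: `E^χ_f = Σ_{γ} Ψ(γ·)` (tex ll. 407–409, pv09/pv15 `Xi_unfold`/`tsum_regroup`);
  `hθΓ`: `θ_Φ(g,·)` is left `U(W)(L₀)`-invariant (automorphy of the theta kernel, N10);
* ANALYTIC, all discharged elsewhere in the package or here — `hF`: Bochner integrability of
  `h ↦ f(h) • ϑ_{T,χ}(ω(h)Φ)` in `C([G_U])` (= N18 continuity, pv11 `ThetaPeriodCont`, + `f ∈ C_c`; see
  `integrable_test_smul` below); absolute convergence `hint` is PROVED here from boundedness/measurability via
  pv14 `P36AbsConv.integrable_unfold_integrand`;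
* pv09 `P36Unfold.unfolding_identity` (scalar unfolding at each `g`) and `P36Unfold.bochner_upgrade_clm`.
CONCLUSION: `D.UnfoldingIdentity`, hence (with `OmegaPreservesKappa`) `D.N23b_statement` by pv14 `Step1Data.N23b_of`.
-/

open MeasureTheory

namespace HodgeCM
namespace PerL34
namespace P36Bridge

variable {U : Type*} [Group U] [MeasurableSpace U] [MeasurableMul₂ U] [MeasurableInv U]
variable {T : Type*} [Group T] [MeasurableSpace T] [MeasurableMul₂ T]
variable {Hw H SK Ch K : Type*} [NormedAddCommGroup Hw] [InnerProductSpace ℂ Hw]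
  [NormedAddCommGroup H] [InnerProductSpace ℂ H] [CompleteSpace H] [TopologicalSpace K] [CompactSpace K]

omit [MeasurableMul₂ T] in
/-- **N23b end to end — the unfolding identity `(U)` of `P36_unfolding.lean` DERIVED.** -/
theorem unfoldingIdentity_of (D : P36Unfolding.Step1Data U Hw H SK Ch)
    [D.dh.IsMulLeftInvariant] [SFinite D.dh]
    (ν : Measure T) [SFinite ν] (jT : T →* U) (hjT : Measurable jT)
    (Γ : Subgroup U) [Countable Γ] {𝓕 : Set U} (h𝓕 : IsFundamentalDomain Γ 𝓕 D.dh)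
    (𝓕T : Set T) (h𝓕T : ν 𝓕T < ⊤)
    (ι : C(K, ℂ) →L[ℂ] H) (θ : SK → K → U → ℂ) (χc : Ch → T → ℂ)
    (ϑc : Ch → SK → C(K, ℂ)) (TE : Ch → (U → ℂ) → C(K, ℂ)) (Efun : Ch → (U → ℂ) → (U → ℂ))
    -- DEFINITIONAL evaluation formulas
    (hTι : ∀ χ, ∀ f ∈ D.Test, D.TΦ (D.E χ f) = ι (TE χ f))
    (hTev : ∀ χ, ∀ f ∈ D.Test, ∀ g, TE χ f g = ∫ y in 𝓕, θ D.Φ g y * Efun χ f y ∂D.dh)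
    (hϑι : ∀ χ Φ', D.ϑ χ Φ' = ι (ϑc χ Φ'))
    (hϑev : ∀ χ Φ' g, ϑc χ Φ' g = ∫ t in 𝓕T, θ Φ' g (jT t) * χc χ t ∂ν)
    (hθω : ∀ h g y, θ (D.omg h D.Φ) g y = θ D.Φ g (y * h))
    (hE : ∀ χ, ∀ f ∈ D.Test, ∀ y,
      HasSum (fun γ : Γ => P36Unfold.Psi ν jT 𝓕T f (χc χ) ((γ : U) * y)) (Efun χ f y))
    (hθΓ : ∀ g (γ : Γ) z, θ D.Φ g ((γ : U) * z) = θ D.Φ g z)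
    -- ANALYTIC hypotheses
    (hθm : ∀ g, Measurable (θ D.Φ g)) (hθb : ∀ g, ∃ C : ℝ, ∀ z, ‖θ D.Φ g z‖ ≤ C)
    (hχm : ∀ χ, Measurable (χc χ)) (hχb : ∀ χ t, ‖χc χ t‖ ≤ 1)
    (hTest : ∀ f ∈ D.Test, Measurable f ∧ Integrable f D.dh)
    (hF : ∀ χ, ∀ f ∈ D.Test, Integrable (fun h => f h • ϑc χ (D.omg h D.Φ)) D.dh) :
    D.UnfoldingIdentity := by
  intro χ f hf
  -- the C(K,ℂ)-valued integrand and its pointwise evaluation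
  set F : U → C(K, ℂ) := fun h => f h • ϑc χ (D.omg h D.Φ) with hFdef
  have hG : ∀ g : K, TE χ f g = ∫ h, F h g ∂D.dh := by
    intro g
    obtain ⟨C, hC⟩ := hθb g
    have hint := P36AbsConv.integrable_unfold_integrand D.dh ν jT hjT h𝓕T (hθm g) (hTest f hf).1 (hχm χ)
      (hTest f hf).2 hC (hχb χ)
    rw [hTev χ f hf g,
      P36Unfold.unfolding_identity D.dh ν jT hjT Γ h𝓕 𝓕T (θ D.Φ g) f (χc χ) (Efun χ f) (hθΓ g) (hE χ f hf) hint]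
    refine integral_congr_ae (ae_of_all _ fun h => ?_)
    show f h * P36Unfold.thetaPeriod ν jT 𝓕T (θ D.Φ g) (χc χ) h = (f h • ϑc χ (D.omg h D.Φ)) g
    rw [ContinuousMap.smul_apply, smul_eq_mul, hϑev]
    unfold P36Unfold.thetaPeriod
    congr 1
    refine integral_congr_ae (ae_of_all _ fun t => ?_)
    show θ D.Φ g (jT t * h) * χc χ t = θ (D.omg h D.Φ) g (jT t) * χc χ t
    rw [hθω]
  -- Bochner upgrade (pv09) and transport along `ι`
  have hup : ι (TE χ f) = ∫ h, ι (F h) ∂D.dh := P36Unfold.bochner_upgrade_clm D.dh ι F (hF χ f hf) _ hG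
  rw [hTι χ f hf, hup]
  refine integral_congr_ae (ae_of_all _ fun h => ?_)
  show ι (f h • ϑc χ (D.omg h D.Φ)) = f h • D.ϑ χ (D.omg h D.Φ)
  rw [map_smul, hϑι]

omit [MeasurableMul₂ T] in
/-- **N23b end to end**: the node's statement from the fundamental-domain model (all hypotheses as in
`unfoldingIdentity_of`) and the DEFINITIONAL `OmegaPreservesKappa` (`ω(h)Φ ∈ 𝒮^κ`, tex l. 418). -/
theorem N23b_of_model (D : P36Unfolding.Step1Data U Hw H SK Ch)
    [D.dh.IsMulLeftInvariant] [SFinite D.dh]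
    (ν : Measure T) [SFinite ν] (jT : T →* U) (hjT : Measurable jT)
    (Γ : Subgroup U) [Countable Γ] {𝓕 : Set U} (h𝓕 : IsFundamentalDomain Γ 𝓕 D.dh)
    (𝓕T : Set T) (h𝓕T : ν 𝓕T < ⊤)
    (ι : C(K, ℂ) →L[ℂ] H) (θ : SK → K → U → ℂ) (χc : Ch → T → ℂ)
    (ϑc : Ch → SK → C(K, ℂ)) (TE : Ch → (U → ℂ) → C(K, ℂ)) (Efun : Ch → (U → ℂ) → (U → ℂ))
    (hTι : ∀ χ, ∀ f ∈ D.Test, D.TΦ (D.E χ f) = ι (TE χ f))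
    (hTev : ∀ χ, ∀ f ∈ D.Test, ∀ g, TE χ f g = ∫ y in 𝓕, θ D.Φ g y * Efun χ f y ∂D.dh)
    (hϑι : ∀ χ Φ', D.ϑ χ Φ' = ι (ϑc χ Φ'))
    (hϑev : ∀ χ Φ' g, ϑc χ Φ' g = ∫ t in 𝓕T, θ Φ' g (jT t) * χc χ t ∂ν)
    (hθω : ∀ h g y, θ (D.omg h D.Φ) g y = θ D.Φ g (y * h))
    (hE : ∀ χ, ∀ f ∈ D.Test, ∀ y,
      HasSum (fun γ : Γ => P36Unfold.Psi ν jT 𝓕T f (χc χ) ((γ : U) * y)) (Efun χ f y))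
    (hθΓ : ∀ g (γ : Γ) z, θ D.Φ g ((γ : U) * z) = θ D.Φ g z)
    (hθm : ∀ g, Measurable (θ D.Φ g)) (hθb : ∀ g, ∃ C : ℝ, ∀ z, ‖θ D.Φ g z‖ ≤ C)
    (hχm : ∀ χ, Measurable (χc χ)) (hχb : ∀ χ t, ‖χc χ t‖ ≤ 1)
    (hTest : ∀ f ∈ D.Test, Measurable f ∧ Integrable f D.dh)
    (hF : ∀ χ, ∀ f ∈ D.Test, Integrable (fun h => f h • ϑc χ (D.omg h D.Φ)) D.dh)
    (hκ : D.OmegaPreservesKappa) : D.N23b_statement :=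
  D.N23b_of (unfoldingIdentity_of D ν jT hjT Γ h𝓕 𝓕T h𝓕T ι θ χc ϑc TE Efun hTι hTev hϑι hϑev hθω hE hθΓ hθm
    hθb hχm hχb hTest hF) hκ

omit [Group U] [MeasurableMul₂ U] [MeasurableInv U] in
/-- The analytic hypothesis `hF` from node N18 (continuity of `h ↦ ϑ_{T,χ}(ω(h)Φ)` into `C([G_U])`, pv11) and
`f ∈ C_c(U(W)(𝔸))` (same one-liner as pv14 `P36Unfolding.integrable_of_continuous_compactSupport`, for the
Banach space `C([G_U])`). -/
theorem integrable_test_smul [TopologicalSpace U] [OpensMeasurableSpace U] (μ : Measure U)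
    [IsFiniteMeasureOnCompacts μ] {f : U → ℂ} (hf : Continuous f) (hfc : HasCompactSupport f)
    {Θ : U → C(K, ℂ)} (hΘ : Continuous Θ) : Integrable (fun h => f h • Θ h) μ :=
  (hf.smul hΘ).integrable_of_hasCompactSupport hfc.smul_right

end P36Bridge
end PerL34
end HodgeCM
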